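/-
Copyright (c) 2026. All rights reserved.
Released under Apache 2.0 license as described in the file LICENSE.
Authors: abc-iut cell, prover seat abc-iut-L4-t6 (gen 14; cell row S3 «ARC-LTIMES-CARRIER», L4-lead m169/m170/m177: "with
the Orb-coarsened `TB⊞` factor"), over this seat's `⋉`-carrier `archGenuinePlus` (files 1–2), abc-iut-w5-d038's orbi-naturality
of the archimedean `η⊢` (`ArchimedeanHolGroupPairsEtaOrb.lean`) and abc-iut-L4-t3's add-ons over the `⋉`-successor.
-/
import Literature.AnabelianGeometry.AbsoluteAnabelian.Ltimes.LogFrobeniusArchGenuinePlusEta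
import Literature.AnabelianGeometry.AbsoluteAnabelian.ArchimedeanHolGroupPairsEtaOrb
import Literature.AnabelianGeometry.AbsoluteAnabelian.ArchimedeanHolGroupPairsEtaNoGo
import Mathlib.CategoryTheory.Quotient
import HarnessLib

/-!
# [AbsTopIII] §0 `Orb(−)`, Def 5.6 (iv), Cor 5.10 (iv)(c): the `⋉`-carrier with genuine archimedean `⊞`-side and
# `Orb`-COARSENED `TB⊞`-factor — `η⊢_{v,ν}` and `MonoTelecoreCoherence` for EVERY Aut-holomorphic field functor, NO cochain

S. Mochizuki, *Topics in absolute anabelian geometry III: global reconstruction algorithms*, J. Math. Sci. Univ.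
Tokyo 22 (2015) 939–1156 [MochizukiAbsTopIII2015]; locators `p.N` = pages of the author's manuscript
(`paper:url-5493eb38cbb7`), read on the page (cell render `AbsTopIII-kurims-url-5493eb38cbb7`): §0 p. 28 l. 22–47 ("we shall
refer to a pair `(S, A)`, where `S ∈ Ob(𝒞)`, and `A ⊆ Aut_𝒞(S)` is a subgroup, as a pre-orbi-object of `𝒞` … A morphism of
pre-orbi-objects `(S₁, A₁) → (S₂, A₂)` is an `A₂`-orbit of morphisms `S₁ → S₂` [relative to the action of `A₂` on the codomain]
that is closed under the action of `A₁` … The category of orbi-objects … `Orb(𝒞)` … a pre-orbi-object may be regarded as an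
orbi-object with precisely one representative … a natural functor `𝒞 → Orb(𝒞)`"), Def 5.6 (i) p. 134 (`TB⊞`: the germ
isomorphism `β : Lie±(B′) ⥲ Lie±(B″)`, `Lie±` = up to `±1`), Def 5.6 (ii)(c) p. 135 ("for each `w ∈ W^arc`, `G_w ∈
Ob(Orb(TM⊢))`"), Def 5.6 (iv) p. 136 (`𝒩⊢⊞_w := Orb(𝒞^{hol⊢}_{TB⊞}) ×_{Orb(TM⊢),w} Th⊢[Z]`), Prop 5.8 (vii) p. 141 ("the object of
`Orb(𝒞^{hol⊢}_{TB⊞}[Γ⃗×_arc])` given by applying the algorithm `G ↦ Γ⃗×_arc(G)` … to the object of `Orb(TM⊢)`"), Cor 5.10 (iv)(c)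
p. 148 (the natural isomorphisms `η⊢_{v,ν}`).

## Why (honest limit (L3) of files 1–2 removed)

Files 1–2 read print's `Orb(−)` as the identity (as every §5 carrier of record does): there the archimedean `η⊢_{v,ν}` of
Cor 5.10 (iv)(c) is natural EXACTLY under abc-iut-w5-d038's orientation cochain for the transition signs — available at the
geometric functor of holomorphic maps, ABSENT at abc-iut-L4-t2's `RC`-model with complex conjugation
(`HolRS.RC.isEmpty_eta_natTrans`).  Print types `𝒩⊢⊞_w` through `Orb(𝒞^{hol⊢}_{TB⊞})`, and abc-iut-w5-d038 proved the content of
that reading: the cochain-free components of `η⊢` are natural UP TO a sign automorphism `(1, ε_φ)` of `k∼(G)` / `k×(G)`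
(`etaTilde_naturality_upToSign`, `etaTimes_naturality_upToSign`) — an automorphism inducing `±1` on the two one-parameter
subgroups, i.e. invisible to `Lie±` (Def 5.6 (i)).  This file builds the `Orb`-coarsened `TB⊞`-factor and the carrier over it:

* `TBPlus.IsSignAut α` — the `Lie±`-SIGN AUTOMORPHISMS of an object `N` of `TB⊞`: `a₁, a₂ ∈ {±1}` (OUR pre-orbi-structure
  `A_N` on every `N`; closed under conjugation by isomorphisms, `IsSignAut.conj`); `TBPlus.SignRel` — §0's orbit relation
  "`g = f ≫ α`, `α ∈ A_N`" on `Hom(M, N)`; ★ `TBPlus.Orb := Quotient SignRel` — **the pre-orbi-objects `(N, A_N)` of `TB⊞` with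
  the `A_N`-orbits of morphisms as morphisms** (§0 p. 28; realised by Mathlib's quotient of `TB⊞` by the congruence generated by
  `SignRel`), `TBPlus.toOrb : TB⊞ ⥤ Orb` (§0's "natural functor `𝒞 → Orb(𝒞)`"), `toOrb_map_eq_of_signRel`;
* `TBPlus.signRel_of_upToSign` — bookkeeping: abc-iut-w5-d038's "natural up to a sign automorphism" squares ARE `SignRel`
  between the two composites through the (inverted) component isomorphisms;
* ★ `HolTFPair.etaTildeOrb 𝔄` / `etaTimesOrb 𝔄` — **`η⊢_{v,pre}` / `η⊢_{v,mult}` as natural isomorphisms of functors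
  `𝒞^hol_TF ⥤ Orb(TB⊞)` for EVERY `𝔄`, NO cochain** (components abc-iut-w5-d038's cochain-free `etaTildeIso`/`etaTimesIso` with
  `c ≡ 1`; naturality = his up-to-sign squares read in `Orb`);
* ★ `LogFrobeniusSettingLtimes.archGenuinePlusOrb 𝔄 Vmod isArc` — file 1's carrier with `𝒩⊢⊞_w := TM⊢ × Orb(TB⊞)` (print:
  `Orb(𝒞^{hol⊢}_{TB⊞}) ×_{Orb(TM⊢)} Th⊢[Z]`), `𝒩⊞_v → 𝒩⊢⊞_v := archMonoNplus ⋙ (𝟭 × toOrb)`, `ψ := ψArc ⋙ (𝟭 × toOrb)`; every other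
  row as in file 1 (genuine `𝒞^hol_{TH⊞}`, `λ⊞`, `ι⊞` on `Γ⃗^⋉_arc`, `toTMMono`, `AnArc`);
* ★★ `archEtaPlusOrb 𝔄 b ν` / `archGenuinePlusOrb_eta` — `η⊢_{v,ν} : γ¹ ⥲ γ⁰` at this carrier for every place and vertex, NO
  HYPOTHESIS; `archGenuinePlusOrb_monoAnalyticizationHomotopies`; ★★★ `archGenuinePlusOrb_monoTelecoreCoherence 𝔄 Vmod isArc` —
  **abc-iut-L4-t3's `MonoTelecoreCoherence` (over `⋉`) INHABITED AT A PRINT-SHAPED ARCHIMEDEAN CARRIER FOR EVERY AUT-HOLOMORPHIC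
  FIELD FUNCTOR `𝔄`, WITH NO HYPOTHESIS** — in particular at abc-iut-L4-t2's `RC`-model, where NO un-coarsened `η⊢` exists
  (`orb_inhabited_where_uncoarsened_eta_empty`).

HONEST LIMITS (named): (L3′) the pre-orbi-structure `A_N` = the `Lie±`-sign automorphisms is OUR reading of the orbi-structure
print induces on `Γ⃗×_arc(G)` from `G_w ∈ Orb(TM⊢)` / `X_v ∈ Orb(EA)` (§0 leaves `A` to the context); the orbit relation is
realised as the congruence GENERATED by `g = f ≫ α` (on the objects met here — `k∼(G)`, `k×(G)`, `(k∼)^{TB⊞}`, `(k^×)^{TB⊞}` — sign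
automorphisms push through every morphism, so nothing more is identified there; not proved in general); only the
`TB⊞`-factor is coarsened (the `TM⊢`-factor and `ℰ⊢ = TM⊢` stay un-coarsened: the coherence "`η⊢` lies over `ℰ⊢`" is read on
the nose); (L2), (L-N⊢), (L4) of file 1 unchanged.  MODEL-LEVEL; a carrier of OUR successor typing, print unchanged; refereed
pre-IUT material; nothing here bears on [IUTchIII] Cor. 3.12; no side taken; instantiated ≠ endorsed; typed ≠ proved.
-/

set_option autoImplicit false

noncomputable section

universe v u

open CategoryTheory

namespace Literature.AnabelianGeometry.AbsoluteAnabelian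

/-! ## §1. `Orb(TB⊞)`: pre-orbi-objects `(N, A_N)`, `A_N` the `Lie±`-sign automorphisms (§0 p. 28, Def 5.6 (i)) -/

namespace TBPlus

variable {M N P : TBPlus.{v}}

/-- **The `Lie±`-sign automorphisms of an object of `TB⊞`**: automorphisms inducing `±1` on `Lie(B′)` and on `Lie(B″)`
(rescalings `a₁, a₂ ∈ {±1}`) — the indeterminacy built into `Lie±` (Def 5.6 (i)); OUR pre-orbi-structure `A_N` on `N` (§0).
[cite: MochizukiAbsTopIII2015, Def 5.6 (i) p. 134] -/
def IsSignAut (α : N ≅ N) : Prop := (α.hom.a₁ = 1 ∨ α.hom.a₁ = -1) ∧ (α.hom.a₂ = 1 ∨ α.hom.a₂ = -1)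

/-- The identity is a sign automorphism. [cite: MochizukiAbsTopIII2015, Def 5.6 (i) p. 134] -/
theorem isSignAut_refl (N : TBPlus.{v}) : IsSignAut (Iso.refl N) := ⟨Or.inl rfl, Or.inl rfl⟩

/-- `A_N` is transported along isomorphisms: the conjugate `e⁻¹ α e` of a sign automorphism of `N` by `e : M ≅ N` is a sign
automorphism of `M` (rescalings multiply, `a(e⁻¹)·a(e) = 1`). [cite: MochizukiAbsTopIII2015, Def 5.6 (i) p. 134] -/
theorem IsSignAut.conj {α : N ≅ N} (hα : IsSignAut α) (e : M ≅ N) : IsSignAut (e ≪≫ α ≪≫ e.symm) := by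
  obtain ⟨h₁, h₂⟩ := hα
  refine ⟨?_, ?_⟩
  · have h : (e ≪≫ α ≪≫ e.symm).hom.a₁ = α.hom.a₁ := by
      change (e.hom ≫ α.hom ≫ e.inv).a₁ = α.hom.a₁
      rw [comp_a₁, comp_a₁]
      calc (e.inv.a₁ * α.hom.a₁) * e.hom.a₁ = α.hom.a₁ * (e.inv.a₁ * e.hom.a₁) := by ring
        _ = α.hom.a₁ := by rw [Iso.inv_a₁_mul_hom_a₁, mul_one]
    rw [h]; exact h₁
  · have h : (e ≪≫ α ≪≫ e.symm).hom.a₂ = α.hom.a₂ := by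
      change (e.hom ≫ α.hom ≫ e.inv).a₂ = α.hom.a₂
      rw [comp_a₂, comp_a₂]
      calc (e.inv.a₂ * α.hom.a₂) * e.hom.a₂ = α.hom.a₂ * (e.inv.a₂ * e.hom.a₂) := by ring
        _ = α.hom.a₂ := by rw [Iso.inv_a₂_mul_hom_a₂, mul_one]
    rw [h]; exact h₂

/-- **§0's orbit relation on `Hom_{TB⊞}(M, N)` for the pre-orbi-objects `(M, A_M)`, `(N, A_N)`**: `g` lies in the `A_N`-orbit of
`f`, i.e. `g = f ≫ α` for a sign automorphism `α` of the codomain. [cite: MochizukiAbsTopIII2015, §0 p. 28] -/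
def SignRel : HomRel TBPlus.{v} := fun _ N f g => ∃ α : N ≅ N, IsSignAut α ∧ g = f ≫ α.hom

/-- ★ **`Orb(TB⊞)`** — the pre-orbi-objects `(N, A_N)` of `TB⊞` (one per object `N`, `A_N` the `Lie±`-sign automorphisms) with
the `A_N`-orbits of `TB⊞`-morphisms as morphisms (§0 p. 28: "a pre-orbi-object may be regarded as an orbi-object with precisely
one representative"); realised as the quotient of `TB⊞` by the congruence generated by `SignRel` (L3′); an `abbrev`, so that Mathlib's
quotient-category structure is found by unification (no instance is declared). [cite: MochizukiAbsTopIII2015, §0 p. 28] -/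
abbrev Orb : Type (v + 1) := CategoryTheory.Quotient SignRel.{v}

/-- **The natural functor `TB⊞ → Orb(TB⊞)`** (§0: "we obtain a natural functor `𝒞 → Orb(𝒞)`"): an object is the pre-orbi-object
it represents, a morphism goes to its orbit. [cite: MochizukiAbsTopIII2015, §0 p. 28] -/
def toOrb : TBPlus.{v} ⥤ Orb.{v} := CategoryTheory.Quotient.functor SignRel.{v}

/-- Two morphisms in the same `A_N`-orbit are EQUAL in `Orb(TB⊞)`. [cite: MochizukiAbsTopIII2015, §0 p. 28] -/
theorem toOrb_map_eq_of_signRel {f g : M ⟶ N} (h : SignRel f g) : toOrb.map f = toOrb.map g :=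
  CategoryTheory.Quotient.sound SignRel h

/-- **Bookkeeping for abc-iut-w5-d038's "natural up to a sign automorphism" squares.**  If `W ≫ e₂ = e₁ ≫ K ≫ α` with `e₁, e₂`
isomorphisms and `α` a sign automorphism of the target of `K`, then the two composites `K ≫ e₂⁻¹` and `e₁⁻¹ ≫ W` through the
INVERTED isomorphisms lie in one `A`-orbit (`α` conjugated by `e₂`). [cite: MochizukiAbsTopIII2015, §0 p. 28] -/
theorem signRel_of_upToSign {T₁ T₂ C₁ C₂ : TBPlus.{v}} (W : T₁ ⟶ T₂) (K : C₁ ⟶ C₂) (e₁ : T₁ ≅ C₁) (e₂ : T₂ ≅ C₂)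
    (α : C₂ ≅ C₂) (hα : IsSignAut α) (h : W ≫ e₂.hom = e₁.hom ≫ K ≫ α.hom) :
    SignRel (K ≫ e₂.inv) (e₁.inv ≫ W) := by
  refine ⟨e₂ ≪≫ α ≪≫ e₂.symm, hα.conj e₂, ?_⟩
  have hW : W = e₁.hom ≫ K ≫ α.hom ≫ e₂.inv := by
    have h' := (Iso.eq_comp_inv e₂).mpr h
    simpa only [Category.assoc] using h'
  rw [hW]
  simp only [Iso.trans_hom, Iso.symm_hom, Category.assoc, Iso.inv_hom_id_assoc]

end TBPlus

/-! ## §2. `η⊢_{v,pre}`, `η⊢_{v,mult}` valued in `Orb(TB⊞)`: natural for EVERY `𝔄`, no cochain -/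

namespace HolTFPair

variable (𝔄 : AutHolFieldFunctor.{u})

/-- The constant cochain `1` is a family of signs. [folklore] -/
private theorem one_or (𝔄 : AutHolFieldFunctor.{u}) : ∀ X : 𝔄.EA, (fun _ : 𝔄.EA => (1 : ℝ)) X = 1 ∨
    (fun _ : 𝔄.EA => (1 : ℝ)) X = -1 := fun _ => Or.inl rfl

/-- ★ **`η⊢_{v,pre}` in `Orb(TB⊞)`, NO cochain**: `k∼(G_𝕏) ⥲ (k∼)^{TB⊞}(𝕏 ↶ k)` as a natural isomorphism of functors
`𝒞^hol_TF ⥤ Orb(TB⊞)`, components the orbits of abc-iut-w5-d038's cochain-free `etaTildeIso⁻¹` (`c ≡ 1`), naturality his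
`etaTilde_naturality_upToSign` read in `Orb` (`signRel_of_upToSign`). [cite: MochizukiAbsTopIII2015, Cor 5.10 (iv)(c) p. 148] -/
def etaTildeOrb : (lamSimPlus 𝔄 ⋙ HolTHPlusPair.toEA 𝔄) ⋙ 𝔄.toTMMono ⋙ TMMono.kTilde ⋙ TBPlus.toOrb.{u + 1} ≅
    lamSimPlus 𝔄 ⋙ HolTHPlusPair.toTBPlus 𝔄 ⋙ TBPlus.uliftFunctor.{u + 1} ⋙ TBPlus.toOrb.{u + 1} :=
  NatIso.ofComponents (fun x => TBPlus.toOrb.mapIso (etaTildeIso (fun _ => (1 : ℝ)) x (one_or 𝔄)).symm) fun {x y} φ => by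
    obtain ⟨α, h₁, h₂, hsq⟩ := etaTilde_naturality_upToSign (𝔄 := 𝔄) φ
    change TBPlus.toOrb.map (TMMono.kTilde.map (𝔄.toTMMono.map φ.base)) ≫
        TBPlus.toOrb.map (etaTildeIso (fun _ => (1 : ℝ)) y (one_or 𝔄)).inv =
      TBPlus.toOrb.map (etaTildeIso (fun _ => (1 : ℝ)) x (one_or 𝔄)).inv ≫
        TBPlus.toOrb.map (TBPlus.uliftFunctor.{u + 1}.map ((HolTHPlusPair.toTBPlus 𝔄).map ((lamSimPlus 𝔄).map φ)))
    rw [← Functor.map_comp, ← Functor.map_comp]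
    refine TBPlus.toOrb_map_eq_of_signRel (TBPlus.signRel_of_upToSign _ _ _ _ α ⟨Or.inl h₁, ?_⟩ hsq)
    rw [h₂]; exact AutHolFieldFunctor.transitionSign_eq_one_or φ.base

/-- ★ **`η⊢_{v,mult}` in `Orb(TB⊞)`, NO cochain**: `k×(G_𝕏) ⥲ (k^×)^{TB⊞}(𝕏 ↶ k)`, naturally in `(𝕏 ↶ k)` for EVERY `𝔄`.
[cite: MochizukiAbsTopIII2015, Cor 5.10 (iv)(c) p. 148] -/
def etaTimesOrb : (lamTimesPlus 𝔄 ⋙ HolTHPlusPair.toEA 𝔄) ⋙ 𝔄.toTMMono ⋙ TMMono.kTimes ⋙ TBPlus.toOrb.{u + 1} ≅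
    lamTimesPlus 𝔄 ⋙ HolTHPlusPair.toTBPlus 𝔄 ⋙ TBPlus.uliftFunctor.{u + 1} ⋙ TBPlus.toOrb.{u + 1} :=
  NatIso.ofComponents (fun x => TBPlus.toOrb.mapIso (etaTimesIso (fun _ => (1 : ℝ)) x (one_or 𝔄)).symm) fun {x y} φ => by
    obtain ⟨α, h₁, h₂, hsq⟩ := etaTimes_naturality_upToSign (𝔄 := 𝔄) φ
    change TBPlus.toOrb.map (TMMono.kTimes.map (𝔄.toTMMono.map φ.base)) ≫
        TBPlus.toOrb.map (etaTimesIso (fun _ => (1 : ℝ)) y (one_or 𝔄)).inv =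
      TBPlus.toOrb.map (etaTimesIso (fun _ => (1 : ℝ)) x (one_or 𝔄)).inv ≫
        TBPlus.toOrb.map (TBPlus.uliftFunctor.{u + 1}.map ((HolTHPlusPair.toTBPlus 𝔄).map ((lamTimesPlus 𝔄).map φ)))
    rw [← Functor.map_comp, ← Functor.map_comp]
    refine TBPlus.toOrb_map_eq_of_signRel (TBPlus.signRel_of_upToSign _ _ _ _ α ⟨Or.inl h₁, ?_⟩ hsq)
    rw [h₂]; exact AutHolFieldFunctor.transitionSign_eq_one_or φ.base

/-- Existence form: the `Orb`-valued `η⊢_{v,pre}` exists for EVERY Aut-holomorphic field functor (no cochain) — contrast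
abc-iut-w5-d038's no-go for the un-coarsened one at the `RC`-model (§5). [cite: MochizukiAbsTopIII2015, Cor 5.10 (iv)(c) p. 148] -/
theorem nonempty_etaTildeOrb : Nonempty ((lamSimPlus 𝔄 ⋙ HolTHPlusPair.toEA 𝔄) ⋙ 𝔄.toTMMono ⋙ TMMono.kTilde ⋙
    TBPlus.toOrb.{u + 1} ≅ lamSimPlus 𝔄 ⋙ HolTHPlusPair.toTBPlus 𝔄 ⋙ TBPlus.uliftFunctor.{u + 1} ⋙ TBPlus.toOrb.{u + 1}) :=
  ⟨etaTildeOrb 𝔄⟩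

end HolTFPair

/-! ## §3. The carrier with `Orb`-coarsened `TB⊞`-factor and its `η⊢_{v,ν}` -/

namespace LogFrobeniusSettingLtimes

variable (𝔄 : AutHolFieldFunctor.{u})

/-- **`𝒩⊞_v = 𝒞^hol_{TH⊞} → 𝒩⊢⊞_v = TM⊢ × Orb(TB⊞)`**: file 1's `archMonoNplus` (`(𝕏 ↶ M) ↦ (G_𝕏, M^{TB⊞})`, genuine in both
components) followed by `TB⊞ → Orb(TB⊞)` on the second factor (Def 5.6 (iv): `𝒩⊢⊞_w := Orb(𝒞^{hol⊢}_{TB⊞}) ×_{Orb(TM⊢)} Th⊢[Z]`).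
[cite: MochizukiAbsTopIII2015, Def 5.6 (iv) p. 136] -/
def archMonoNplusOrb : Up (HolTHPlusPair 𝔄) ⥤ TMMono.{u + 1} × TBPlus.Orb.{u + 1} :=
  archMonoNplus 𝔄 ⋙ (𝟭 TMMono.{u + 1}).prod TBPlus.toOrb.{u + 1}

/-- **`ψ^{An⊢⊞}_{w,ν} : An⊢[𝒩⊢⊞_w] → TM⊢ × Orb(TB⊞)`**: abc-iut-w6-d025's genuine `ψArc` (`k∼(G)` at `pre`, `k×(G)` at `mult`) read in
`Orb(TB⊞)` (Prop 5.8 (vii): "the object of `Orb(𝒞^{hol⊢}_{TB⊞}[Γ⃗×_arc])` given by applying the algorithm `G ↦ Γ⃗×_arc(G)`").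
[cite: MochizukiAbsTopIII2015, Prop 5.8 (vii) p. 141] -/
def ψArcOrb (b : Bool) (ν : LogVertex b) : TMMono.AnArc.{u + 1} ⥤ TMMono.{u + 1} × TBPlus.Orb.{u + 1} :=
  TMMono.ψArc b ν ⋙ (𝟭 TMMono.{u + 1}).prod TBPlus.toOrb.{u + 1}

/-- ★ **The `⋉`-carrier with genuine archimedean `⊞`-side and `Orb`-coarsened `TB⊞`-factor**: file 1's `archGenuinePlus 𝔄` with
`𝒩⊢⊞_w := TM⊢ × Orb(TB⊞)`, `𝒩⊞_v → 𝒩⊢⊞_v := archMonoNplusOrb`, `ψ := ψArcOrb`; all other rows verbatim (`𝒞^hol_{TH⊞}`, `λ⊞`, `ι⊞` on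
`Γ⃗^⋉_arc`, `EA → TM⊢`, `AnArc`, `𝒩⊢_w = ℰ⊢ = TM⊢` un-coarsened). [cite: MochizukiAbsTopIII2015, Def 5.6 (iv) p. 136] -/
def archGenuinePlusOrb (Vmod : Type (u + 1)) (isArc : Vmod → Bool) : LogFrobeniusSettingLtimes Vmod isArc :=
  { archGenuinePlus 𝔄 Vmod isArc with
    NmonoPlus := fun _ => TMMono.{u + 1} × TBPlus.Orb.{u + 1}
    catNmonoPlus := fun _ => inferInstance
    forgetMono := fun _ => CategoryTheory.Prod.fst _ _
    monoNplus := fun _ => archMonoNplusOrb 𝔄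
    monoHomotopy := fun _ => Iso.refl _
    ψAnMono := fun w ν => ψArcOrb (isArc w) ν.1 }

variable (Vmod : Type (u + 1)) (isArc : Vmod → Bool)

/-- The holomorphic side is file 1's, verbatim. [cite: MochizukiAbsTopIII2015, Def 5.4 (vi) p. 128] -/
theorem archGenuinePlusOrb_lam (v : Vmod) : (archGenuinePlusOrb 𝔄 Vmod isArc).lam v = archLamPlus 𝔄 (isArc v) := rfl

/-- `𝒩⊢⊞_w = TM⊢ × Orb(TB⊞)`. [cite: MochizukiAbsTopIII2015, Def 5.6 (iv) p. 136] -/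
theorem archGenuinePlusOrb_NmonoPlus (w : Vmod) :
    (archGenuinePlusOrb 𝔄 Vmod isArc).NmonoPlus w = (TMMono.{u + 1} × TBPlus.Orb.{u + 1}) := rfl

/-- "`ψ^{An⊢⊞}_{w,ν}` lies over `ℰ⊢`" ON THE NOSE (the `TM⊢`-factor is not coarsened). [cite: MochizukiAbsTopIII2015, Prop 5.8 (vii) p. 141] -/
theorem archGenuinePlusOrb_ψOver (w : Vmod) (ν : {ν : LogVertex (isArc w) // ν.IsCross}) :
    (archGenuinePlusOrb 𝔄 Vmod isArc).ψAnMono w ν ⋙ (archGenuinePlusOrb 𝔄 Vmod isArc).forgetMono w ⋙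
        (archGenuinePlusOrb 𝔄 Vmod isArc).toEmono w =
      (archGenuinePlusOrb 𝔄 Vmod isArc).κAnMono.inverse := rfl

/-- The `Orb(TB⊞)`-component of `η⊢_{v,ν}`, per kind of place and vertex (`etaTimesOrb` at the archimedean `k^×`, `etaTildeOrb`
at every vertex reading `k∼`), for EVERY `𝔄`. [cite: MochizukiAbsTopIII2015, Cor 5.10 (iv)(c) p. 148] -/
def archEtaSndOrb : (b : Bool) → (ν : LogVertex b) →
    ((archLamPlusBase 𝔄 b ν ⋙ HolTHPlusPair.toEA 𝔄) ⋙ 𝔄.toTMMono ⋙ TMMono.arcContainer b ν ⋙ TBPlus.toOrb.{u + 1} ≅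
      archLamPlusBase 𝔄 b ν ⋙ HolTHPlusPair.toTBPlus 𝔄 ⋙ TBPlus.uliftFunctor.{u + 1} ⋙ TBPlus.toOrb.{u + 1})
  | true, ArchVertex.mult => HolTFPair.etaTimesOrb 𝔄
  | true, ArchVertex.postLog => HolTFPair.etaTildeOrb 𝔄
  | true, ArchVertex.pre => HolTFPair.etaTildeOrb 𝔄
  | true, ArchVertex.spaceLink => HolTFPair.etaTildeOrb 𝔄
  | false, _ => HolTFPair.etaTildeOrb 𝔄

/-- ★★ **`η⊢_{v,ν} : γ¹_{v,ν} ⥲ γ⁰_{v,ν}` at the `Orb`-carrier, for every kind of place and EVERY vertex, NO HYPOTHESIS**: the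
identity of `G_𝕏` on the `TM⊢`-component, `archEtaSndOrb` on the `Orb(TB⊞)`-component.
[cite: MochizukiAbsTopIII2015, Cor 5.10 (iv)(c) p. 148] -/
def archEtaPlusOrb (b : Bool) (ν : LogVertex b) :
    archLamPlus 𝔄 b ν ⋙ Up.liftF (HolTHPlusPair.forgetTH 𝔄) ⋙ Up.liftF (HolTHPair.toEA 𝔄) ⋙
        (inducedFunctor _ ⋙ 𝔄.toTMMono) ⋙ TMMono.anArcEquiv.{u + 1}.functor ⋙ ψArcOrb b ν ≅
      archLamPlus 𝔄 b ν ⋙ archMonoNplusOrb 𝔄 :=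
  NatIso.ofComponents
    (fun x => Iso.prod (Iso.refl _) ((archEtaSndOrb 𝔄 b ν).app x.down))
    (fun f => Prod.ext ((Category.comp_id _).trans (Category.id_comp _).symm)
      ((archEtaSndOrb 𝔄 b ν).hom.naturality f.hom))

/-- ★★ `η⊢_{v,ν}` in the binder shape of the add-on's field `eta`, at the `Orb`-carrier, every place and cross vertex, NO
hypothesis. [cite: MochizukiAbsTopIII2015, Cor 5.10 (iv)(c) p. 148] -/
def archGenuinePlusOrb_eta (v : Vmod) (ν : LogVertex (isArc v)) (hν : ν.IsCross) :
    (archGenuinePlusOrb 𝔄 Vmod isArc).lam v ν ⋙ (archGenuinePlusOrb 𝔄 Vmod isArc).forget v ⋙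
        (archGenuinePlusOrb 𝔄 Vmod isArc).toE v ⋙ (archGenuinePlusOrb 𝔄 Vmod isArc).monoAn ⋙
          (archGenuinePlusOrb 𝔄 Vmod isArc).κAnMono.functor ⋙ (archGenuinePlusOrb 𝔄 Vmod isArc).ψAnMono v ⟨ν, hν⟩ ≅
      (archGenuinePlusOrb 𝔄 Vmod isArc).lam v ν ⋙ (archGenuinePlusOrb 𝔄 Vmod isArc).monoNplus v :=
  archEtaPlusOrb 𝔄 (isArc v) ν

/-! ## §4. The add-ons at the `Orb`-carrier: inhabited for EVERY `𝔄`, no hypothesis -/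

/-- (a)+(b) at the `Orb`-carrier: rows 4 → 5 the identity, rows 6 → 7 the unit of `Th⊢ ⥲ An⊢` (as in file 2).
[cite: MochizukiAbsTopIII2015, Cor 5.10 p. 146] -/
def archGenuinePlusOrb_monoAnalyticizationHomotopies :
    (archGenuinePlusOrb 𝔄 Vmod isArc).MonoAnalyticizationHomotopies where
  toE _ := Iso.refl _
  anToE := Functor.isoWhiskerLeft
    ((archGenuinePlusOrb 𝔄 Vmod isArc).κAn.inverse ⋙ (archGenuinePlusOrb 𝔄 Vmod isArc).monoAn)
    (archGenuinePlusOrb 𝔄 Vmod isArc).κAnMono.unitIso.symm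

/-- Cor 5.10 (iv)(a) at the `Orb`-carrier for `V(F_mod) ≠ ∅`. [cite: MochizukiAbsTopIII2015, Cor 5.10 (iv)(a) p. 147] -/
theorem archGenuinePlusOrb_cor510MonoCores [Nonempty Vmod] : (archGenuinePlusOrb 𝔄 Vmod isArc).Cor510MonoCores :=
  cor510MonoCores_holds (archGenuinePlusOrb_monoAnalyticizationHomotopies 𝔄 Vmod isArc)

/-- ★★★ **abc-iut-L4-t3's add-on `MonoTelecoreCoherence` (over `⋉`) INHABITED at the `Orb`-carrier FOR EVERY Aut-holomorphic
field functor `𝔄`, every index `(Vmod, isArc)`, WITH NO HYPOTHESIS**: `psiOver` the identity, `eta := archGenuinePlusOrb_eta`, and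
the coherence "`η⊢` lies over `ℰ⊢`" by identities on the un-coarsened base (`TMMono.anArcEquiv_unitIso_inv_app`).
[cite: MochizukiAbsTopIII2015, Cor 5.10 (iv)(c) p. 148] -/
def archGenuinePlusOrb_monoTelecoreCoherence :
    (archGenuinePlusOrb 𝔄 Vmod isArc).MonoTelecoreCoherence
      (archGenuinePlusOrb_monoAnalyticizationHomotopies 𝔄 Vmod isArc) where
  psiOver _ _ := Iso.refl _
  eta v ν hν := archGenuinePlusOrb_eta 𝔄 Vmod isArc v ν hν
  eta_over v ν hν y := by
    change 𝟙 _ ≫ 𝟙 _ ≫ 𝟙 _ = 𝟙 _ ≫ TMMono.anArcEquiv.unitIso.inv.app _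
    rw [TMMono.anArcEquiv_unitIso_inv_app]
    simp only [Category.comp_id]
    rfl

/-- ★★★ **Existence form, NO hypothesis**: for every `𝔄` and every index, the `Orb`-carrier carries both add-ons.
[cite: MochizukiAbsTopIII2015, Cor 5.10 (iv)(c) p. 148] -/
theorem exists_orb_monoTelecoreCoherence :
    ∃ (Lt : LogFrobeniusSettingLtimes Vmod isArc) (M : Lt.MonoAnalyticizationHomotopies),
      Nonempty (Lt.MonoTelecoreCoherence M) ∧ Lt.X = Up (HolTFPair 𝔄) ∧ (∀ v, Lt.Nplus v = Up (HolTHPlusPair 𝔄)) ∧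
        ∀ w, Lt.NmonoPlus w = (TMMono.{u + 1} × TBPlus.Orb.{u + 1}) :=
  ⟨archGenuinePlusOrb 𝔄 Vmod isArc, archGenuinePlusOrb_monoAnalyticizationHomotopies 𝔄 Vmod isArc,
    ⟨archGenuinePlusOrb_monoTelecoreCoherence 𝔄 Vmod isArc⟩, rfl, fun _ => rfl, fun _ => rfl⟩

end LogFrobeniusSettingLtimes

/-! ## §5. Contrast at abc-iut-L4-t2's `RC`-model: no un-coarsened `η⊢`, yet the `Orb`-carrier carries the add-on -/

namespace HolRS.RC

/-- ★★ **At the `RC`-model** (geometric Aut-holomorphic field functor WITH complex conjugations, any class `Q` containing the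
complex plane): the un-coarsened archimedean `η⊢_{v,pre}` does NOT exist along a conjugation (abc-iut-w5-d038's
`isEmpty_etaTilde_iso_of_complexPlane`), while the `Orb`-carrier over the same functor carries abc-iut-L4-t3's full coherence
add-on with no hypothesis. [cite: MochizukiAbsTopIII2015, Rmk 5.8.1 (i) p. 142] -/
theorem orb_inhabited_where_uncoarsened_eta_empty (Q : ObjectProperty RC) (hQ : Q ⟨complexPlane⟩) (Vmod : Type 1)
    (isArc : Vmod → Bool) :
    IsEmpty (HolTFPair.lamSimPlus (geometricAutHolFieldFunctorRC Q) ⋙ HolTHPlusPair.toTBPlus _ ⋙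
        TBPlus.uliftFunctor.{1} ≅ HolTFPair.toEA _ ⋙ (geometricAutHolFieldFunctorRC Q).toTMMono ⋙ TMMono.kTilde) ∧
      Nonempty ((LogFrobeniusSettingLtimes.archGenuinePlusOrb (geometricAutHolFieldFunctorRC Q) Vmod isArc).MonoTelecoreCoherence
        (LogFrobeniusSettingLtimes.archGenuinePlusOrb_monoAnalyticizationHomotopies (geometricAutHolFieldFunctorRC Q) Vmod isArc)) :=
  ⟨isEmpty_etaTilde_iso_of_complexPlane Q hQ,
    ⟨LogFrobeniusSettingLtimes.archGenuinePlusOrb_monoTelecoreCoherence _ Vmod isArc⟩⟩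

end HolRS.RC

end Literature.AnabelianGeometry.AbsoluteAnabelian

end
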